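import Mathlib
import Summits.ValiantsHypothesis.ValiantsHypothesis.Theorems.ValuativeGCTValuativeFlipSliceBound

/-!
# Few-row slice bound for row-wise sandwich invariants (det side of line `four-row-count`)

Stub `stub_fourRowSliceBound` of line `four-row-count`, crux `ValuativeGCT.ValuativeFlip`
(stmt-ValiantsHypothesis-12624), proved in the general form over a set `S` of kept row slots: for
`m ≥ 2`, degree-`D` polynomials in the rows `A_j ∈ Mat_m` (`j ∈ S`) invariant under the row-wise
unimodular sandwich `A_j ↦ P A_j Q` span a space of dimension `≤ (D+1)^(m + (#S - 2)·m²)`; for the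
last four slots this is the registered `(D+1)^(2m² + m)`.  Proof = B1
(`Theorems/ValuativeGCTValuativeFlipSliceBound.lean`) transported to few rows with two sharpenings:
the unimodular pair `P = a K⁻¹`, `Q = b A_{j₀}⁻¹ K` (`K` = Krylov matrix of `A_{j₁} A_{j₀}⁻¹`) puts a
generic `A` in the linear slice `{A_{j₀} = u·1, A_{j₁} = u·shift + last column, A_j free (j ∈ S ∖
{j₀,j₁})}` with ONE shared scalar `u`; generic points are Zariski dense (`MvPolynomial.funext`), so
the slice projection (killing slots outside `S`) is injective on invariants supported on `S`, and a
degree-`D` monomial in the slice variables is determined by its exponents off `u`.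
Elementary linear algebra over `ℂ`; no named facts are used.
-/
set_option linter.dupNamespace false

namespace Summit.ValiantsHypothesis.ValiantsHypothesis.Theorems.ValuativeFlip

open MvPolynomial
open scoped BigOperators Matrix
open Literature.NumberTheory.DiophantineGeometry

noncomputable section

section Krylov

variable {R : Type*} [CommRing R] {N : ℕ} [NeZero N]

/-- Determinant of the Krylov matrix of a scalar multiple (column `k` scales by `c ^ k`).
[folklore] -/
theorem det_sbKry_smul (c : R) (B : Matrix (Fin N) (Fin N) R) :
    (sbKry (c • B)).det = (∏ k : Fin N, c ^ (k : ℕ)) * (sbKry B).det := by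
  rw [← Matrix.det_mul_row]
  congr 1
  ext a k
  simp only [sbKry, Matrix.of_apply, smul_pow, Matrix.smul_apply, smul_eq_mul]

end Krylov

/-- Evaluation only sees the supported variables: if `G` is supported on `T` and two points agree
on `T` then `G` takes the same value at them. [folklore] -/
theorem eval_eq_eval_of_mem_supported {σ : Type*} {T : Set σ} {G : MvPolynomial σ ℂ}
    (hG : G ∈ supported ℂ T) {x x' : σ → ℂ} (h : ∀ p ∈ T, x p = x' p) :
    eval x G = eval x' G := by
  rw [supported_eq_range_rename, AlgHom.mem_range] at hG
  obtain ⟨q, rfl⟩ := hG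
  rw [eval_rename, eval_rename]
  have hx : x ∘ Subtype.val = (x' ∘ Subtype.val : T → ℂ) := funext fun p => h p.1 p.2
  rw [hx]

/-- Row-major index of a slot: `idx (toLex (a, b)) = b + N·a`. [folklore] -/
theorem matIdxEquiv_symm_toLex_val {N : ℕ} (a b : Fin N) :
    (((matIdxEquiv N).symm (toLex (a, b)) : Fin (N * N)) : ℕ) = b + N * a := by
  have h : (matIdxEquiv N).symm (toLex (a, b)) = finProdFinEquiv (a, b) := by
    apply (matIdxEquiv N).injective
    rw [OrderIso.apply_symm_apply, matIdxEquiv_apply, Equiv.symm_apply_apply]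
  rw [h]
  rfl

variable (t : ℕ)

variable (S : Set (MatIdx (t + 2))) [DecidablePred (· ∈ S)] (j₀ j₁ : MatIdx (t + 2))

/-- The density polynomial for the slots `j₀, j₁`: `h = det X_{j₀} · det Kry(X_{j₁} adj X_{j₀})`.
[folklore] -/
def frH : MvPolynomial (MatIdx (t + 2) × MatIdx (t + 2)) ℂ :=
  (sbSlot (fun p => X p) j₀).det *
    (sbKry (sbSlot (fun p => X p) j₁ * (sbSlot (fun p => X p) j₀).adjugate)).det

/-- Evaluation of the density polynomial. [folklore] -/
theorem eval_frH (x : MatIdx (t + 2) × MatIdx (t + 2) → ℂ) :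
    eval x (frH t j₀ j₁) = (sbSlot x j₀).det *
      (sbKry (sbSlot x j₁ * (sbSlot x j₀).adjugate)).det := by
  simp only [frH, map_mul, RingHom.map_det, RingHom.mapMatrix_apply, sbKry_map, Matrix.map_mul]
  rw [← RingHom.mapMatrix_apply (eval x) (sbSlot _ _).adjugate, RingHom.map_adjugate,
    RingHom.mapMatrix_apply, sbSlot_map_eval, sbSlot_map_eval]

/-- The test point: slot `j₁` is the shift, all other slots are the identity. [folklore] -/
def frTest : MatIdx (t + 2) × MatIdx (t + 2) → ℂ :=
  fun p => (if p.1 = j₁ then sbShift ℂ (t + 2) else (1 : Matrix (Fin (t + 2)) (Fin (t + 2)) ℂ))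
    (ofLex p.2).1 (ofLex p.2).2

/-- Slots of the test point. [folklore] -/
theorem sbSlot_frTest (j : MatIdx (t + 2)) :
    sbSlot (frTest t j₁) j = if j = j₁ then sbShift ℂ (t + 2) else 1 := by
  ext c d
  simp only [sbSlot, frTest, Matrix.of_apply, ofLex_toLex]

variable {j₀ j₁} in
/-- The density polynomial is nonzero: it is `1` at the test point. [folklore] -/
theorem frH_ne_zero (h01 : j₀ ≠ j₁) : frH t j₀ j₁ ≠ 0 := fun h => by
  have := eval_frH t j₀ j₁ (frTest t j₁)
  rw [h, map_zero, sbSlot_frTest, sbSlot_frTest, if_neg h01, if_pos rfl,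
    Matrix.det_one, Matrix.adjugate_one, Matrix.mul_one, sbKry_shift, Matrix.det_one, one_mul] at this
  exact zero_ne_one this

/-- The slice variables: ONE scalar `u` (shared by slot `j₀` and the subdiagonal of slot `j₁`),
the last column of slot `j₁`, and all entries of the kept slots `j ∈ S ∖ {j₀, j₁}`. [folklore] -/
abbrev frVar : Type :=
  Unit ⊕ (Fin (t + 2) ⊕ {p : MatIdx (t + 2) × MatIdx (t + 2) // p.1 ∈ S ∧ ¬(p.1 = j₀ ∨ p.1 = j₁)})

/-- The linear coordinate projection onto the slice: `X (j₀, (c,d)) ↦ [c = d] u`,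
`X (j₁, (c, last)) ↦ v_c`, `X (j₁, (c, d)) ↦ [c = d + 1] u` for `d ≠ last`,
`X (j, i) ↦ X (j, i)` for the other kept slots, and `X (j, i) ↦ 0` for `j ∉ S`. [folklore] -/
def frProj (p : MatIdx (t + 2) × MatIdx (t + 2)) : MvPolynomial (frVar t S j₀ j₁) ℂ :=
  if h0 : p.1 = j₀ then
    (if (ofLex p.2).1 = (ofLex p.2).2 then X (Sum.inl ()) else 0)
  else if h1 : p.1 = j₁ then
    (if (ofLex p.2).2 = Fin.last (t + 1) then X (Sum.inr (Sum.inl (ofLex p.2).1))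
      else if ((ofLex p.2).1 : ℕ) = (ofLex p.2).2 + 1 then X (Sum.inl ()) else 0)
  else if hS : p.1 ∈ S then X (Sum.inr (Sum.inr ⟨p, hS, not_or.mpr ⟨h0, h1⟩⟩))
  else 0

/-- Each coordinate of the projection is a linear form (a variable or zero). [folklore] -/
theorem frProj_isHomogeneous (p : MatIdx (t + 2) × MatIdx (t + 2)) :
    (frProj t S j₀ j₁ p).IsHomogeneous 1 := by
  unfold frProj
  split_ifs <;> first | exact isHomogeneous_X _ _ | exact isHomogeneous_zero _ _ _

/-- The section of the projection: slice coordinates of a point in normal form. [folklore] -/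
def frSec (y : MatIdx (t + 2) × MatIdx (t + 2) → ℂ) : frVar t S j₀ j₁ → ℂ
  | Sum.inl _ => y (j₀, toLex (0, 0))
  | Sum.inr (Sum.inl a) => y (j₁, toLex (a, Fin.last (t + 1)))
  | Sum.inr (Sum.inr p) => y p.1

variable {S j₀ j₁} in
/-- On points in normal form (slot `j₀` equal to `u·1`, slot `j₁` with subdiagonal `u` in its first
`N - 1` columns and free last column) the projection followed by the section reproduces the point
on the kept slots and kills the others. [folklore] -/
theorem eval_frSec_frProj (hj₀ : j₀ ∈ S) (hj₁ : j₁ ∈ S)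
    {y : MatIdx (t + 2) × MatIdx (t + 2) → ℂ} {u : ℂ}
    (hy0 : sbSlot y j₀ = u • (1 : Matrix (Fin (t + 2)) (Fin (t + 2)) ℂ))
    (hy1 : ∀ c d : Fin (t + 2), (d : ℕ) + 1 < t + 2 →
      sbSlot y j₁ c d = if (c : ℕ) = d + 1 then u else 0) :
    (fun p => eval (frSec t S j₀ j₁ y) (frProj t S j₀ j₁ p)) =
      fun p => if p.1 ∈ S then y p else 0 := by
  have e0 : ∀ c d, y (j₀, toLex (c, d)) = if c = d then u else 0 := fun c d => by
    rw [show y (j₀, toLex (c, d)) = sbSlot y j₀ c d from rfl, hy0, Matrix.smul_apply,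
      Matrix.one_apply, smul_eq_mul, mul_ite, mul_one, mul_zero]
  have eu : y (j₀, toLex (0, 0)) = u := by rw [e0]; simp
  funext p
  obtain ⟨j, i⟩ := p
  obtain ⟨⟨c, d⟩, rfl⟩ : ∃ cd : Fin (t + 2) × Fin (t + 2), toLex cd = i := ⟨ofLex i, toLex_ofLex i⟩
  unfold frProj
  simp only [ofLex_toLex]
  by_cases h0 : j = j₀
  · subst h0
    rw [dif_pos rfl, if_pos hj₀, e0 c d]
    split_ifs <;> simp [frSec, eu]
  · rw [dif_neg h0]
    by_cases h1 : j = j₁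
    · subst h1
      rw [dif_pos rfl, if_pos hj₁]
      by_cases hl : d = Fin.last (t + 1)
      · subst hl
        simp [frSec]
      · have hd : (d : ℕ) + 1 < t + 2 := by have := Fin.val_lt_last hl; omega
        have e1 : y (_, toLex (c, d)) = if (c : ℕ) = d + 1 then u else 0 := hy1 c d hd
        rw [if_neg hl, e1]
        split_ifs <;> simp [frSec, eu]
    · rw [dif_neg h1]
      by_cases hS : j ∈ S
      · rw [dif_pos hS, if_pos hS]
        simp [frSec]
      · rw [dif_neg hS, if_neg hS, map_zero]

variable {S j₀ j₁} in
/-- Generic points (`h ≠ 0`) have a unimodular sandwich in the image of the slice: with `K` the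
Krylov matrix of `B = x_{j₁} x_{j₀}⁻¹`, `P = a K⁻¹`, `Q = b x_{j₀}⁻¹ K` make slot `j₀` the scalar `ab`
and slot `j₁` `ab` times a companion matrix with UNIT subdiagonal. [folklore: Krylov normal form] -/
theorem fr_exists_unimodular (hj₀ : j₀ ∈ S) (hj₁ : j₁ ∈ S)
    (x : MatIdx (t + 2) × MatIdx (t + 2) → ℂ) (hx : eval x (frH t j₀ j₁) ≠ 0) :
    ∃ P Q : Matrix (Fin (t + 2)) (Fin (t + 2)) ℂ, P.det = 1 ∧ Q.det = 1 ∧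
      ∃ z : frVar t S j₀ j₁ → ℂ, (fun p => eval z (frProj t S j₀ j₁ p)) =
        fun p => if p.1 ∈ S then sbSand P Q x p else 0 := by
  rw [eval_frH] at hx
  set A₀ := sbSlot x j₀ with hA₀
  set A₁ := sbSlot x j₁ with hA₁
  have hd : A₀.det ≠ 0 := left_ne_zero_of_mul hx
  have hdu : IsUnit A₀.det := isUnit_iff_ne_zero.mpr hd
  set B := A₁ * A₀⁻¹ with hB
  set K := sbKry B with hK
  have hadj : A₀.adjugate = A₀.det • A₀⁻¹ := by
    rw [Matrix.inv_def, smul_smul, Ring.mul_inverse_cancel _ hdu, one_smul]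
  have hKd : K.det ≠ 0 := by
    have h2 : (sbKry (A₁ * A₀.adjugate)).det ≠ 0 := right_ne_zero_of_mul hx
    rw [hadj, Matrix.mul_smul, det_sbKry_smul] at h2
    exact right_ne_zero_of_mul h2
  obtain ⟨a, haP⟩ := sb_exists_smul_det_one t K⁻¹ (by
    rw [Matrix.det_nonsing_inv, Ring.inverse_eq_inv']; exact inv_ne_zero hKd)
  obtain ⟨b, hbQ⟩ := sb_exists_smul_det_one t (A₀⁻¹ * K) (by
    rw [Matrix.det_mul, Matrix.det_nonsing_inv, Ring.inverse_eq_inv']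
    exact mul_ne_zero (inv_ne_zero hd) hKd)
  refine ⟨a • K⁻¹, b • (A₀⁻¹ * K), haP, hbQ, _,
    eval_frSec_frProj t hj₀ hj₁ (u := a * b) ?_ fun c d hd1 => ?_⟩
  · rw [sbSlot_sbSand, ← hA₀, Matrix.smul_mul, Matrix.mul_smul, Matrix.smul_mul, smul_smul,
      Matrix.mul_assoc, ← Matrix.mul_assoc A₀, Matrix.mul_nonsing_inv _ hdu, Matrix.one_mul,
      Matrix.nonsing_inv_mul _ (isUnit_iff_ne_zero.mpr hKd), mul_comm b a]
  · have h1 : sbSlot (sbSand (a • K⁻¹) (b • (A₀⁻¹ * K)) x) j₁ =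
        (a * b) • (K⁻¹ * B * K) := by
      rw [sbSlot_sbSand, ← hA₁, Matrix.smul_mul, Matrix.mul_smul, Matrix.smul_mul, smul_smul, hB,
        mul_comm b a]
      simp only [Matrix.mul_assoc]
    rw [h1, Matrix.smul_apply, hK, sbKry_conj_apply _ (hK ▸ hKd) c d hd1]
    simp

variable {S j₀ j₁} in
/-- Density: a sandwich-invariant polynomial supported on the kept slots and killed by the slice
projection is zero (`G · h` vanishes identically and `h ≠ 0`). [folklore: Zariski density] -/
theorem fr_eq_zero_of_aeval_frProj (h01 : j₀ ≠ j₁) (hj₀ : j₀ ∈ S) (hj₁ : j₁ ∈ S)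
    (G : MvPolynomial (MatIdx (t + 2) × MatIdx (t + 2)) ℂ)
    (hG : ∀ P Q : Matrix (Fin (t + 2)) (Fin (t + 2)) ℂ, P.det = 1 → Q.det = 1 →
      aeval (sbSubst P Q) G = G)
    (hGS : G ∈ supported ℂ {p : MatIdx (t + 2) × MatIdx (t + 2) | p.1 ∈ S})
    (hψ : aeval (frProj t S j₀ j₁) G = 0) : G = 0 := by
  have hGH : G * frH t j₀ j₁ = 0 := by
    apply MvPolynomial.funext
    intro x
    rw [map_mul, map_zero]
    by_cases hx : eval x (frH t j₀ j₁) = 0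
    · rw [hx, mul_zero]
    · obtain ⟨P, Q, hP, hQ, z, hz⟩ := fr_exists_unimodular t hj₀ hj₁ x hx
      have hsupp : eval (sbSand P Q x) G = eval (fun p => if p.1 ∈ S then sbSand P Q x p else 0) G :=
        eval_eq_eval_of_mem_supported hGS fun p hp => by rw [if_pos (show p.1 ∈ S from hp)]
      rw [← hG P Q hP hQ, eval_aeval_sbSubst, hsupp, ← hz, ← sb_eval_aeval, hψ, map_zero, zero_mul]
  exact (mul_eq_zero.mp hGH).resolve_right (frH_ne_zero t h01)

/-- Sharpened count: degree-`D` forms in the variables `Unit ⊕ τ` span a space of dimension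
`≤ (D+1)^(#τ)` (a degree-`D` monomial is determined by its exponents on `τ`, each `≤ D`). [folklore] -/
theorem fr_finrank_homogeneousSubmodule_le (τ : Type*) [Fintype τ] (D : ℕ) :
    Module.finrank ℂ ↥(homogeneousSubmodule (Unit ⊕ τ) ℂ D) ≤ (D + 1) ^ Fintype.card τ := by
  classical
  let e : (τ → Fin (D + 1)) → ((Unit ⊕ τ) →₀ ℕ) := fun g =>
    Finsupp.equivFunOnFinite.symm fun i => Sum.elim (fun _ => D - ∑ j, (g j : ℕ)) (fun j => (g j : ℕ)) i
  let b : (τ → Fin (D + 1)) → MvPolynomial (Unit ⊕ τ) ℂ := fun g => monomial (e g) 1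
  have hle : homogeneousSubmodule (Unit ⊕ τ) ℂ D ≤ Submodule.span ℂ (Set.range b) := by
    intro φ hφ
    rw [mem_homogeneousSubmodule] at hφ
    rw [φ.as_sum]
    refine Submodule.sum_mem _ fun d hd => ?_
    have hdeg : d.degree = D := by
      by_contra h
      exact (mem_support_iff.mp hd) (hφ.coeff_eq_zero h)
    rw [Finsupp.degree_eq_sum, Fintype.sum_sum_type] at hdeg
    simp only [Finset.univ_unique, PUnit.default_eq_unit, Finset.sum_singleton] at hdeg
    have hdi : ∀ i, d (Sum.inr i) < D + 1 := fun i =>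
      Nat.lt_succ_of_le (le_trans (Finset.single_le_sum (fun j _ => Nat.zero_le (d (Sum.inr j)))
        (Finset.mem_univ i)) (by omega))
    have hed : e (fun i => ⟨d (Sum.inr i), hdi i⟩) = d := by
      ext i
      rcases i with ⟨⟨⟩⟩ | i
      · simp only [e, Finsupp.coe_equivFunOnFinite_symm, Sum.elim_inl]
        omega
      · simp [e]
    have : monomial d (coeff d φ) = coeff d φ • b (fun i => ⟨d (Sum.inr i), hdi i⟩) := by
      rw [smul_monomial, smul_eq_mul, mul_one, hed]
    rw [this]
    exact Submodule.smul_mem _ _ (Submodule.subset_span (Set.mem_range_self _))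
  haveI : Module.Finite ℂ (Submodule.span ℂ (Set.range b)) :=
    Module.Finite.iff_fg.mpr (Submodule.fg_span (Set.finite_range b))
  calc Module.finrank ℂ ↥(homogeneousSubmodule (Unit ⊕ τ) ℂ D)
      ≤ Module.finrank ℂ (Submodule.span ℂ (Set.range b)) := Submodule.finrank_mono hle
    _ ≤ Fintype.card (τ → Fin (D + 1)) := finrank_range_le_card b
    _ = (D + 1) ^ Fintype.card τ := by rw [Fintype.card_fun, Fintype.card_fin]

variable {S j₀ j₁} in
/-- The few-row slice bound at `N = t + 2`, general kept set `S ∋ j₀, j₁`: the restriction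
`aeval frProj` is injective on the homogeneous sandwich invariants supported on the slots in `S`
and lands in degree-`D` forms in the slice variables. [folklore] -/
theorem fr_finrank_le_pow_card (h01 : j₀ ≠ j₁) (hj₀ : j₀ ∈ S) (hj₁ : j₁ ∈ S) (D : ℕ) :
    Module.finrank ℂ ↥(homogeneousSubmodule (MatIdx (t + 2) × MatIdx (t + 2)) ℂ D ⊓
        (⨅ (P : Matrix (Fin (t + 2)) (Fin (t + 2)) ℂ) (Q : Matrix (Fin (t + 2)) (Fin (t + 2)) ℂ)
          (_ : P.det = 1) (_ : Q.det = 1),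
          LinearMap.ker ((aeval (sbSubst P Q)).toLinearMap - LinearMap.id)) ⊓
        Subalgebra.toSubmodule (supported ℂ {p : MatIdx (t + 2) × MatIdx (t + 2) | p.1 ∈ S})) ≤
      (D + 1) ^ Fintype.card
        (Fin (t + 2) ⊕ {p : MatIdx (t + 2) × MatIdx (t + 2) // p.1 ∈ S ∧ ¬(p.1 = j₀ ∨ p.1 = j₁)}) := by
  haveI : Module.Finite ℂ ↥(homogeneousSubmodule (frVar t S j₀ j₁) ℂ D) :=
    Module.Finite.iff_fg.mpr (homogeneousSubmodule_fg _ _ _)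
  refine (LinearMap.finrank_le_finrank_of_injective
    (f := (((aeval (frProj t S j₀ j₁)).toLinearMap.domRestrict _).codRestrict
      (homogeneousSubmodule (frVar t S j₀ j₁) ℂ D) fun w => ?_)) ?_).trans
    (fr_finrank_homogeneousSubmodule_le _ D)
  · -- the restriction preserves degree-`D` forms
    have h := ((mem_homogeneousSubmodule D w.1).mp
      (Submodule.mem_inf.mp (Submodule.mem_inf.mp w.2).1).1).aeval (frProj t S j₀ j₁)
      (frProj_isHomogeneous t S j₀ j₁)
    rw [one_mul] at h
    exact h
  · -- the restriction is injective on invariants supported on the kept slots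
    rw [injective_iff_map_eq_zero]
    intro w hw
    have h2 := (Submodule.mem_inf.mp (Submodule.mem_inf.mp w.2).1).2
    have h3 : w.1 ∈ supported ℂ {p : MatIdx (t + 2) × MatIdx (t + 2) | p.1 ∈ S} :=
      (Submodule.mem_inf.mp w.2).2
    refine Subtype.ext (fr_eq_zero_of_aeval_frProj t h01 hj₀ hj₁ _ (fun P Q hP hQ => ?_) h3
      (congrArg Subtype.val hw))
    simp only [Submodule.mem_iInf, LinearMap.mem_ker, LinearMap.sub_apply, sub_eq_zero] at h2
    exact h2 P Q hP hQ

/-! ## The last four row slots -/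

/-- First distinguished kept slot `j₀ = (last, last)` (row-major index `N² - 1`). [folklore] -/
def frJ0 : MatIdx (t + 2) := toLex (Fin.last (t + 1), Fin.last (t + 1))

/-- Second distinguished kept slot `j₁ = (last, last - 1)` (row-major index `N² - 2`). [folklore] -/
def frJ1 : MatIdx (t + 2) := toLex (Fin.last (t + 1), ⟨t, by omega⟩)

/-- `j₀ ≠ j₁`. [folklore] -/
theorem frJ0_ne_frJ1 : frJ0 t ≠ frJ1 t := by simp [frJ0, frJ1, Fin.ext_iff]

/-- The set of the last four row slots (`N² ≤ idx j + 4`; reducible, so that membership is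
decidable by `Nat.decLe`). [folklore] -/
abbrev frRows4 : Set (MatIdx (t + 2)) :=
  {j | (t + 2) * (t + 2) ≤ (((matIdxEquiv (t + 2)).symm j : Fin ((t + 2) * (t + 2))) : ℕ) + 4}

/-- `j₀` is kept. [folklore] -/
theorem frJ0_mem : frJ0 t ∈ frRows4 t := by
  show (t + 2) * (t + 2) ≤ _ + 4
  rw [frJ0, matIdxEquiv_symm_toLex_val, Fin.val_last]
  nlinarith

/-- `j₁` is kept. [folklore] -/
theorem frJ1_mem : frJ1 t ∈ frRows4 t := by
  show (t + 2) * (t + 2) ≤ _ + 4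
  rw [frJ1, matIdxEquiv_symm_toLex_val, Fin.val_last]
  simp only
  nlinarith

/-- At most four slots are kept. [folklore] -/
theorem card_frRows4_le : Fintype.card (frRows4 t) ≤ 4 := by
  let f : frRows4 t → Fin 4 := fun j =>
    ⟨(((matIdxEquiv (t + 2)).symm j.1 : Fin ((t + 2) * (t + 2))) : ℕ) + 4 - (t + 2) * (t + 2), by
      have h1 := ((matIdxEquiv (t + 2)).symm j.1).2
      have h2 : (t + 2) * (t + 2) ≤ _ + 4 := j.2
      omega⟩
  refine le_of_le_of_eq (Fintype.card_le_of_injective f ?_) (Fintype.card_fin 4)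
  rintro ⟨j, hj⟩ ⟨j', hj'⟩ h
  have h2 : (t + 2) * (t + 2) ≤ _ + 4 := hj
  have h2' : (t + 2) * (t + 2) ≤ _ + 4 := hj'
  simp only [f, Fin.mk.injEq] at h
  have hv : (((matIdxEquiv (t + 2)).symm j : Fin ((t + 2) * (t + 2))) : ℕ) =
      ((matIdxEquiv (t + 2)).symm j' : Fin ((t + 2) * (t + 2))) := by omega
  exact Subtype.ext ((matIdxEquiv (t + 2)).symm.injective (Fin.ext hv))

/-- The free kept slots contribute at most `2 N²` slice variables. [folklore] -/
theorem card_frFree_le :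
    Fintype.card {p : MatIdx (t + 2) × MatIdx (t + 2) //
        p.1 ∈ frRows4 t ∧ ¬(p.1 = frJ0 t ∨ p.1 = frJ1 t)} ≤ 2 * (t + 2) ^ 2 := by
  rw [Fintype.card_congr (Equiv.prodSubtypeFstEquivSubtypeProd
      (p := fun j : MatIdx (t + 2) => j ∈ frRows4 t ∧ ¬(j = frJ0 t ∨ j = frJ1 t))),
    Fintype.card_prod, Fintype.card_lex, Fintype.card_prod, Fintype.card_fin, sq]
  refine Nat.mul_le_mul_right _ ?_
  have hsub : ({frJ0 t, frJ1 t} : Finset (MatIdx (t + 2))) ⊆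
      Finset.univ.filter (· ∈ frRows4 t) := by
    intro j hj
    simp only [Finset.mem_insert, Finset.mem_singleton] at hj
    rcases hj with rfl | rfl
    · exact Finset.mem_filter.mpr ⟨Finset.mem_univ _, frJ0_mem t⟩
    · exact Finset.mem_filter.mpr ⟨Finset.mem_univ _, frJ1_mem t⟩
  have heq : Finset.univ.filter (fun j : MatIdx (t + 2) => j ∈ frRows4 t ∧ ¬(j = frJ0 t ∨ j = frJ1 t)) =
      Finset.univ.filter (· ∈ frRows4 t) \ {frJ0 t, frJ1 t} := by
    ext j
    simp only [Finset.mem_filter, Finset.mem_univ, true_and, Finset.mem_sdiff, Finset.mem_insert,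
      Finset.mem_singleton]
  have h4 := card_frRows4_le t
  rw [Fintype.card_subtype] at h4 ⊢
  rw [heq, Finset.card_sdiff_of_subset hsub, Finset.card_pair (frJ0_ne_frJ1 t)]
  omega

/-- **Four-row slice bound** (registered stub `stub_fourRowSliceBound` of line `four-row-count`,
det side, verbatim).  For `m ≥ 2` and every `D`, the degree-`D` polynomials on `End W` (variables
`X (j, i)`, row slot `j`, position `i`) supported on the last four row slots (`m² ≤ idx j + 4`) and
invariant under the row-wise unimodular sandwich `A_j ↦ P A_j Q` span a space of dimension
`≤ (D+1)^(2m² + m)`: `fr_finrank_le_pow_card` with `j₀ = (last,last)`, `j₁ = (last,last-1)`, a slice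
of `1 + m + 2m²` linear coordinates, exponent of the shared scalar forced (Krull dimension of
`ℂ[Mat_m⁴]^{SL_m × SL_m}` is `2m² + 2`). [folklore: Krylov normal form; Zariski density] -/
theorem stub_fourRowSliceBound :
    ∀ (m : ℕ), 2 ≤ m → ∀ D : ℕ,
      Module.finrank ℂ ↥(MvPolynomial.homogeneousSubmodule (MatIdx m × MatIdx m) ℂ (D) ⊓
        (⨅ (P : Matrix (Fin m) (Fin m) ℂ) (Q : Matrix (Fin m) (Fin m) ℂ) (_ : P.det = 1) (_ : Q.det = 1), LinearMap.ker ((MvPolynomial.aeval fun p : MatIdx m × MatIdx m => ∑ l : MatIdx m, (P (ofLex p.2).1 (ofLex l).1 * Q (ofLex l).2 (ofLex p.2).2) • (MvPolynomial.X (p.1, l) : MvPolynomial (MatIdx m × MatIdx m) ℂ)).toLinearMap - (LinearMap.id : MvPolynomial (MatIdx m × MatIdx m) ℂ →ₗ[ℂ] MvPolynomial (MatIdx m × MatIdx m) ℂ))) ⊓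
        Subalgebra.toSubmodule (MvPolynomial.supported ℂ {p : MatIdx m × MatIdx m | m * m ≤ (((matIdxEquiv m).symm p.1 : Fin (m * m)) : ℕ) + 4})) ≤ (D + 1) ^ (2 * m ^ 2 + m) := by
  intro m hm D
  obtain ⟨t, rfl⟩ : ∃ t, m = t + 2 := ⟨m - 2, by omega⟩
  refine (fr_finrank_le_pow_card t (S := frRows4 t) (frJ0_ne_frJ1 t) (frJ0_mem t) (frJ1_mem t)
    D).trans (Nat.pow_le_pow_right (Nat.succ_pos D) ?_)
  rw [Fintype.card_sum, Fintype.card_fin]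
  have := card_frFree_le t
  nlinarith

end

end Summit.ValiantsHypothesis.ValiantsHypothesis.Theorems.ValuativeFlip
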